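import Summits.NavierStokesRegularity.NavierStokesRegularity.Theses.PalasekTowerBreakdown
import Summits.NavierStokesRegularity.FluidComputer.PalasekTowerFaceLayerAtEnvelope

/-!
# NavierStokesRegularity — route `PalasekTowerBreakdown` (rev 19, `TowerRates.tuned`), item `HeredityFromTwoT`:
# the five-face cut at every level `k ≥ 2`, BY NAME on the route decl

Supports `stmt-NavierStokesRegularity-20305` (`HeredityFromTwoT := HeredityFromGAt TowerRates.tuned 2`; it does NOT
close it and nobody claims it). Cell `ns-blowup`, seat `ns-blowup-fc-prover-2` (g9; planner g23 word STATUS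
2026-08-27T11:06Z (b)). LABEL: E–C typing (pure glue over the R-generic face layer
`FluidComputer/PalasekTowerFaceLayerAt{,Envelope}.lean`). WHAT THIS IS NOT: not NS — no stage, tower or instance is
constructed; the item and its faces are OPEN and appear only inside equivalences / implications.

* `palasekTowerBreakdown_heredityFromTwoT_iff_forall_heredityAt : HeredityFromTwoT ↔ ∀ k ≥ 2, HeredityAtGAt tuned k`;
* `palasekTowerBreakdown_heredityFromTwoT_of_faces` — from the five faces `NoPrematureBreakdownGAt`, `WindowCeilingGAt`,
  `SpeedFloorGAt`, `StrainFloorGAt`, `CoreFloorGAt` at every `(tuned, k)`, `k ≥ 2` (what a five-stub birth line on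
  20305 registers);
* `palasekTowerBreakdown_heredityFromTwoT_iff_forall_faces` — LOSSLESS;
* `palasekTowerBreakdown_heredityFromTwoT_iff_forall_apriori_and_floors` — the two halves at every level `k ≥ 2`;
* `palasekTowerBreakdown_heredityFromTwoT_iff_orBreakdown_and_noPrematureBreakdown`.

References: S. Palasek, arXiv:2605.13827 §4 [cite: Palasek2026ElementaryModel, §4]; H. Sohr, *The Navier–Stokes
Equations*, Birkhäuser 2001, Ch. V Thm. 1.5.1 [cite: Sohr2001, Ch. V Thm. 1.5.1]; J. C. Robinson, J. L. Rodrigo,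
W. Sadowski, CUP 2016, Thm. 8.17 [cite: RobinsonRodrigoSadowski2016, Thm. 8.17].
-/

-- `Summit.<Summit>.<Problem>` is the tree's mandated summit-side namespace (CONVENTIONS §2); for this
-- single-conjunct summit the two coincide, so the duplicate is deliberate.
set_option linter.dupNamespace false

namespace Summit.NavierStokesRegularity.NavierStokesRegularity.Theorems

open Summit.NavierStokesRegularity.NavierStokesRegularity.Theses
open Summit.NavierStokesRegularity.FluidComputer.PalasekTowerClayBridge

/-- `HeredityFromTwoT ↔ ∀ k ≥ 2, HeredityAtGAt tuned k` (quantifier reshuffling). [folklore] -/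
theorem palasekTowerBreakdown_heredityFromTwoT_iff_forall_heredityAt :
    PalasekTowerBreakdown.HeredityFromTwoT ↔ ∀ k, 2 ≤ k → HeredityAtGAt TowerRates.tuned k := by
  unfold PalasekTowerBreakdown.HeredityFromTwoT
  exact ⟨fun h k hk => h.heredityAt hk, fun h S hP hR hQ k hk s => h k hk S hP hR hQ s⟩

/-- **Item `HeredityFromTwoT` from the five faces at every `(tuned, k)`, `k ≥ 2`** (the composition a five-stub birth
line on stmt-NavierStokesRegularity-20305 registers; body `heredityFromGAt_of_faces` with `readoutFloorsGAt_of_floors`).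
[cite: Palasek2026ElementaryModel, §4] -/
theorem palasekTowerBreakdown_heredityFromTwoT_of_faces
    (hN : ∀ k, 2 ≤ k → NoPrematureBreakdownGAt TowerRates.tuned k)
    (hW : ∀ k, 2 ≤ k → WindowCeilingGAt TowerRates.tuned k)
    (h₁ : ∀ k, 2 ≤ k → SpeedFloorGAt TowerRates.tuned k)
    (h₂ : ∀ k, 2 ≤ k → StrainFloorGAt TowerRates.tuned k)
    (h₃ : ∀ k, 2 ≤ k → CoreFloorGAt TowerRates.tuned k) :
    PalasekTowerBreakdown.HeredityFromTwoT := by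
  unfold PalasekTowerBreakdown.HeredityFromTwoT
  exact heredityFromGAt_of_faces hN hW (fun k hk => readoutFloorsGAt_of_floors (h₁ k hk) (h₂ k hk) (h₃ k hk))

/-- **The five-face cut of `HeredityFromTwoT` is LOSSLESS**: `HeredityFromTwoT ↔ ∀ k ≥ 2, NoPrematureBreakdownGAt tuned k ∧
WindowCeilingGAt tuned k ∧ SpeedFloorGAt tuned k ∧ StrainFloorGAt tuned k ∧ CoreFloorGAt tuned k`. [cite: Sohr2001, Ch. V Thm. 1.5.1] -/
theorem palasekTowerBreakdown_heredityFromTwoT_iff_forall_faces :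
    PalasekTowerBreakdown.HeredityFromTwoT ↔ ∀ k, 2 ≤ k →
      NoPrematureBreakdownGAt TowerRates.tuned k ∧ WindowCeilingGAt TowerRates.tuned k ∧
        SpeedFloorGAt TowerRates.tuned k ∧ StrainFloorGAt TowerRates.tuned k ∧ CoreFloorGAt TowerRates.tuned k := by
  rw [palasekTowerBreakdown_heredityFromTwoT_iff_forall_heredityAt]
  exact forall₂_congr fun k _ => heredityAtGAt_iff_noPrematureBreakdown_windowCeiling_floors3 k

/-- **The two halves at every level `k ≥ 2`**: `HeredityFromTwoT ↔ ∀ k ≥ 2, AprioriCeilingGAt tuned k ∧ ReadoutFloorsGAt tuned k`.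
[cite: RobinsonRodrigoSadowski2016, Thm. 8.17] -/
theorem palasekTowerBreakdown_heredityFromTwoT_iff_forall_apriori_and_floors :
    PalasekTowerBreakdown.HeredityFromTwoT ↔ ∀ k, 2 ≤ k →
      AprioriCeilingGAt TowerRates.tuned k ∧ ReadoutFloorsGAt TowerRates.tuned k := by
  rw [palasekTowerBreakdown_heredityFromTwoT_iff_forall_heredityAt]
  exact forall₂_congr fun k hk => heredityAtGAt_iff_apriori_and_floors (le_trans one_le_two hk)

/-- `HeredityFromTwoT ↔ HeredityOrBreakdownFromGAt tuned 2 ∧ ∀ k ≥ 2, NoPrematureBreakdownGAt tuned k` — the or-breakdown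
weakening plus the clauses whose failure IS (C). [folklore] -/
theorem palasekTowerBreakdown_heredityFromTwoT_iff_orBreakdown_and_noPrematureBreakdown :
    PalasekTowerBreakdown.HeredityFromTwoT ↔
      HeredityOrBreakdownFromGAt TowerRates.tuned 2 ∧ ∀ k, 2 ≤ k → NoPrematureBreakdownGAt TowerRates.tuned k := by
  unfold PalasekTowerBreakdown.HeredityFromTwoT
  exact heredityFromGAt_iff_orBreakdown_and_noPrematureBreakdown 2

end Summit.NavierStokesRegularity.NavierStokesRegularity.Theorems
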